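import Summits.CriticalPhenomena.SAWScalingLimit.Theorems.HexTight.Negative.OutwardDiveFalse

/-!
# Ring counterexamples for crux `HexTight` (stmt-CriticalPhenomena-5423), part 10:
`DSR.PinnedReturnBound` (line `differentiated-sum-rule`, conclusion of `stub_pinnedReturn_of`) is FALSE

Line lead seat c6 (2026-08-16). `DSR.PinnedReturnBound` (`Negative/OutwardDiveDefs.lean`, a
token-for-token copy of `Cruxes/HexTight/Lines/differentiated-sum-rule.lean` §C) is
Kemppainen–Smirnov's Condition G2 in CONSTANT form for INWARD unforced annulus crossings of the
`x_c`-weighted hexagonal SAW, conditionally on any past. It is the conclusion of the registered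
stub `stub_pinnedReturn_of : BallReturnBound → PinnedReturnBound` and a hypothesis of
`stub_traversalBound_of`. It fails in the SAME ring as `OutwardDiveBound` (part 9), read backwards
(Disproof §7): source `a = U(0,2K)` (top row), past `[a]`, target `b = U(0,0)` (the centre of the
annulus), the right arm `armC` of `A(c(b); r, M r)` is an unforced annulus component (the reversed
left route avoids it), the inner ball touches the boundary at `b`, and the REVERSED rightward SAW
crosses the arm inward while carrying more than half of the total weight (reversal is a
weight-preserving bijection, `weight_univ_reverse`).

Main result: `not_pinnedReturnBoundAsTyped : ¬ DSR.PinnedReturnBound`. Consequently the registered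
stub `stub_pinnedReturn_of` of `differentiated-sum-rule` can only hold if its hypothesis
`BallReturnBound` is false, and `stub_traversalBound_of : PinnedReturnBound → …` is vacuous.
-/

noncomputable section

open scoped BigOperators ENNReal
open Classical
open Literature.Probability.LatticeModels
open Literature.Probability.RandomPlanarGeometry.SAW

namespace Summit.CriticalPhenomena.SAWScalingLimit.Cruxes.HexTight.Negative

/-- the right arm `armC[K, r, R]` of `Negative/OutwardDiveFalse.lean` (notation, local to this
file): bottom-row ring cells right of the centre at distance in `(r, R)` from `x₀` -/
local notation3 "armC[" K ", " r ", " R "]" =>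
  {y : HexVertex | y ∈ ring K ∧ y.1 1 = 0 ∧ x₀.re + 1 / 2 ≤ (hexCenter y).re ∧
    r < dist (hexCenter y) x₀ ∧ dist (hexCenter y) x₀ < R}

variable {K : ℕ} {r R : ℝ}

/-! ## Reversal -/

/-- **Reversal preserves the total weight**: reversing a SAW of `Ω_1` is a bijection between the
SAWs `b → a` and `a → b` preserving the number of cells. -/
theorem weight_univ_reverse {a b : HexVertex} :
    hexSAWWeight (Omega K) 1 b a Set.univ = hexSAWWeight (Omega K) 1 a b Set.univ := by
  rw [weight_apply, weight_apply]
  simp only [Set.indicator_univ]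
  refine Fintype.sum_bijective (fun γ : HexDomainSAW (Omega K) 1 b a =>
    (⟨γ.walk.reverse, γ.isPath.reverse⟩ : HexDomainSAW (Omega K) 1 a b))
    ⟨fun γ γ' h => ?_, fun γ => ⟨⟨γ.walk.reverse, γ.isPath.reverse⟩, ?_⟩⟩ _ _ (fun γ => ?_)
  · have h' := congrArg (fun γ'' : HexDomainSAW (Omega K) 1 a b => γ''.walk.support.reverse) h
    simp only [SimpleGraph.Walk.support_reverse, List.reverse_reverse] at h'
    exact saw_eq_of_support_eq h'
  · exact saw_eq_of_support_eq (by simp)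
  · simp [EmbDomainSAW.vertexCount, EmbDomainSAW.length, SimpleGraph.Walk.length_reverse]

/-! ## The reversed rightward SAW crosses the arm inward -/

/-- indices of a decomposition `L₁ ++ w :: (L₂ ++ u :: L₃)` (far cell first) -/
theorem getElem?_decomp_in {α : Type*} (L₁ L₂ L₃ : List α) (w u : α) :
    (L₁ ++ w :: (L₂ ++ u :: L₃))[L₁.length]? = some w ∧
    (L₁ ++ w :: (L₂ ++ u :: L₃))[L₁.length + (L₂.length + 1)]? = some u ∧
    ∀ k, L₁.length < k → k < L₁.length + (L₂.length + 1) →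
      ∃ y, (L₁ ++ w :: (L₂ ++ u :: L₃))[k]? = some y ∧ y ∈ L₂ := by
  refine ⟨?_, ?_, ?_⟩
  · rw [List.getElem?_append_right le_rfl, Nat.sub_self]; rfl
  · rw [List.getElem?_append_right (by omega), Nat.add_sub_cancel_left, List.getElem?_cons_succ,
      List.getElem?_append_right le_rfl, Nat.sub_self]
    rfl
  · intro k hk1 hk2
    obtain ⟨k', rfl⟩ : ∃ k', k = L₁.length + (k' + 1) := ⟨k - L₁.length - 1, by omega⟩
    rw [List.getElem?_append_right (by omega), Nat.add_sub_cancel_left, List.getElem?_cons_succ,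
      List.getElem?_append_left (by omega)]
    have hk' : k' < L₂.length := by omega
    exact ⟨L₂[k'], List.getElem?_eq_getElem hk', List.getElem_mem hk'⟩

/-- **The reversed rightward SAW crosses the right arm inward** (read from its first cell on). -/
theorem futureCrossesIn_right_reverse (hK : 1 ≤ K) (hRK : R ≤ K) (hr0 : 0 < r) (hRr : r + 2 ≤ R)
    (γR : HexDomainSAW (Omega K) 1 (U 0 0) (U 0 (2 * K))) (hT : ∀ y ∈ γR.walk.support, y ∈ Tpos K) :
    DSR.FutureCrossesIn γR.walk.reverse.support 0 (armC[K, r, R]) 1 x₀ r R := by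
  obtain ⟨l₁, l₂, l₃, u, u', w, hdec, hu, hw, harm⟩ := exists_arm_block hK hRK hr0 hRr γR hT
  have hrev : γR.walk.reverse.support = l₃.reverse ++ w :: ((u' :: l₂).reverse ++ u :: l₁.reverse) := by
    rw [SimpleGraph.Walk.support_reverse, hdec]
    simp
  obtain ⟨hi, hj, hk⟩ := getElem?_decomp_in l₃.reverse (u' :: l₂).reverse l₁.reverse w u
  rw [← hrev] at hi hj hk
  refine ⟨l₃.reverse.length, l₃.reverse.length + ((u' :: l₂).reverse.length + 1), Nat.zero_le _,
    by simp, ⟨w, hi, by rwa [pos_one]⟩, ⟨u, hj, by rwa [pos_one]⟩, fun k hk1 hk2 => ?_⟩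
  obtain ⟨y, hyk, hymem⟩ := hk k hk1 hk2
  exact ⟨y, hyk, harm y (List.mem_reverse.1 hymem)⟩

/-! ## The refutation -/

/-- **`PinnedReturnBound` is false as typed** (`= DifferentiatedSumRule.PinnedReturnBound`, the
conclusion of the registered stub `stub_pinnedReturn_of` of the line `differentiated-sum-rule`;
Disproof §7, the weighted ring read backwards): in `Ω_1 = Omega K` with source `U(0,2K)`, past
`[U(0,2K)]`, target the centre `U(0,0)`, the right arm of `A(x₀; r, M r)` is an unforced annulus
component crossed INWARD by the reversed rightward SAW, which carries more than half of the total
`x_c`-weight. -/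
theorem not_pinnedReturnBoundAsTyped : ¬ DSR.PinnedReturnBound := by
  rintro ⟨M, r₀, hM, hr₀, h⟩
  -- radii: `r ≥ r₀`, `R = M r ≥ r + 2`
  set r : ℝ := max r₀ (2 / (M - 1)) with hr
  have hr0 : 0 < r := hr₀.trans_le (le_max_left _ _)
  have hrr₀ : r₀ * 1 ≤ r := by rw [mul_one]; exact le_max_left _ _
  have hRr : r + 2 ≤ M * r := by
    have hM1 : 0 < M - 1 := by linarith
    have h2 : 2 / (M - 1) ≤ r := le_max_right _ _
    rw [div_le_iff₀ hM1] at h2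
    nlinarith
  -- the ring size `K ≥ R`
  obtain ⟨K, hK, hRK⟩ : ∃ K : ℕ, 1 ≤ K ∧ M * r ≤ K :=
    ⟨⌈M * r⌉₊ + 1, by omega, (Nat.le_ceil _).trans (by exact_mod_cast Nat.le_succ _)⟩
  -- the rightward SAW and its reverse
  obtain ⟨γR, hT, hvc⟩ := exists_right_saw hK
  obtain ⟨tR, hRsupp⟩ := snd_eq_of_Tpos hK γR hT
  set γR' : HexDomainSAW (Omega K) 1 (U 0 (2 * K)) (U 0 0) := ⟨γR.walk.reverse, γR.isPath.reverse⟩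
    with hγR'
  have hvc' : γR'.vertexCount = γR.vertexCount := by
    simp [hγR', EmbDomainSAW.vertexCount, EmbDomainSAW.length, SimpleGraph.Walk.length_reverse]
  -- instantiate the bound in the ring, read backwards
  have key := h (Omega K) (isBounded_Omega K) 1 one_pos (U 0 (2 * K)) (U 0 0) [U 0 (2 * K)]
    (List.cons_ne_nil _ _) x₀ r hrr₀ (innerTouches hK hr0.le _) (armC[K, r, M * r])
    (isAnnulusComponent_armC hK hRK hr0 hRr _) (unforced_armC' hK _)
  -- left side ≥ 2 x_c^{ℓ_R}, right side ≤ x_c^{ℓ_R} + x_c^{14K-1}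
  have hmem : γR' ∈ {γ : HexDomainSAW (Omega K) 1 (U 0 (2 * K)) (U 0 0) |
      [U 0 (2 * K)] <+: γ.walk.support ∧
        DSR.FutureCrossesIn γ.walk.support ([U 0 (2 * (K : ℤ))].length - 1) (armC[K, r, M * r]) 1
          x₀ r (M * r)} :=
    ⟨⟨γR'.walk.support.tail, γR'.walk.cons_tail_support⟩,
      futureCrossesIn_right_reverse hK hRK hr0 hRr γR hT⟩
  have h1 := le_weight_of_mem hmem
  rw [hvc'] at h1
  have h2 : hexSAWWeight (Omega K) 1 (U 0 (2 * K)) (U 0 0)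
      {γ : HexDomainSAW (Omega K) 1 (U 0 (2 * K)) (U 0 0) | [U 0 (2 * K)] <+: γ.walk.support} ≤
      ENNReal.ofReal (hexCriticalFugacity ^ γR.vertexCount) +
        ENNReal.ofReal (hexCriticalFugacity ^ (14 * K - 1)) := by
    refine (MeasureTheory.measure_mono (Set.subset_univ _)).trans ?_
    rw [weight_univ_reverse]
    exact weight_le hK hRsupp Set.univ
  exact not_two_mul_le hK hvc ((mul_le_mul_right h1 2).trans (key.trans h2))

end Summit.CriticalPhenomena.SAWScalingLimit.Cruxes.HexTight.Negative

end
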